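import Mathlib
import HarnessLib
import Summits.ValiantsHypothesis.ValiantsHypothesis.Theorems.LacunarySymmetroidMatrixDescartesOsculationLawPeelSimpleBranches
import Summits.ValiantsHypothesis.ValiantsHypothesis.Theorems.LacunarySymmetroidMatrixDescartesOsculationLawPeelTripleRoot
import Summits.ValiantsHypothesis.ValiantsHypothesis.Theorems.LacunarySymmetroidMatrixDescartesOsculationLawPeelReflect

/-!
# ValiantsHypothesis / LacunarySymmetroid — crux `MatrixDescartes` (stmt-ValiantsHypothesis-18050, V1),
# line `Cruxes/MatrixDescartes/Lines/osculation_law.lean` («osculation-law»), stub `stub_peel`: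
# THE END COST AT RANK THREE — `mult₀(P t) ≤ ord_t a₀` for real-rooted cubic coefficient curves

The one analytic input of the general-`r` peel (`…PeelGeneral.peelInequalityAt_of_endCost`, hypothesis `hEC`) at
`r = 3`, where every multiplicity is `≤ 3` and the tree already holds each case: for a coefficient curve
`a₀, a₁, a₂, a₃ ∈ ℝ[t]`, `a₀ ≢ 0`, whose fibres `Σ_{k≤3} X^k C(a_k(t))` are real-rooted for `t > 0`, and `t > 0` with a
non-zero fibre, `rootMultiplicity 0 (fibre) ≤ rootMultiplicity t a₀`:
multiplicity `1` — `a₀(t) = 0`; multiplicity `2` — an exactly-double root of a hyperbolic family is not a fold,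
`∂_t Φ(t, 0) = a₀'(t) = 0` (val-lit-p7 g12's `no_fold_hyperbolic`, p616635); multiplicity `3` — the cubic discriminant
forces `ord_t a₀ ≥ 3` (val-port-4 g1's `three_le_rootMultiplicity_of_triple_root`, p621133).
* `eval_pderiv_zero_at_zero` — `∂_tΦ(t, 0) = a₀'(t)` for the coefficient form;
* **`endCost_three`**.
Honest framing: a rank-`3` LEMMA toward the OPEN stub `stub_peel`; the general-`r` end cost (AKLM 1998, Lemma 3.7) is
NOT proved here; `MatrixDescartes`, the LAW and `VP ≠ VNP` are NOT proved.  No definitions, no named facts.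
(val-lit-p4 g13, helper `--supports stmt-ValiantsHypothesis-18050`; desk RULING #279 (a).)
-/

-- `Summit.ValiantsHypothesis.ValiantsHypothesis.…` is the tree's mandated single-conjunct layout (Sub = Summit).
set_option linter.dupNamespace false

noncomputable section

namespace Summit.ValiantsHypothesis.ValiantsHypothesis.Theorems.LacunarySymmetroidMatrixDescartes

open Polynomial Set Filter
open MvPolynomial (pderiv)
open scoped BigOperators Topology

namespace OsculationPeel

/-- **`∂_tΦ(t, 0) = a₀'(t)`** for the coefficient form `Φ = Σ_{k≤r} X₁^k·ι(a_k)`. [folklore] -/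
theorem eval_pderiv_zero_at_zero (r : ℕ) (a : ℕ → ℝ[X]) (t : ℝ) :
    MvPolynomial.eval ![t, 0] (pderiv 0 (∑ k ∈ Finset.range (r + 1), (MvPolynomial.X 1 : MvPolynomial (Fin 2) ℝ) ^ k *
        Polynomial.aeval (MvPolynomial.X 0 : MvPolynomial (Fin 2) ℝ) (a k))) = (derivative (a 0)).eval t := by
  have h1 := hasDerivAt_eval_horizontal (∑ k ∈ Finset.range (r + 1), (MvPolynomial.X 1 : MvPolynomial (Fin 2) ℝ) ^ k *
        Polynomial.aeval (MvPolynomial.X 0 : MvPolynomial (Fin 2) ℝ) (a k)) t 0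
  have hfun : (fun s => MvPolynomial.eval ![s, 0] (∑ k ∈ Finset.range (r + 1),
      (MvPolynomial.X 1 : MvPolynomial (Fin 2) ℝ) ^ k * Polynomial.aeval (MvPolynomial.X 0 : MvPolynomial (Fin 2) ℝ) (a k)))
      = fun s => (a 0).eval s := by
    funext s
    rw [← eval_coeffForm, eval_zero_coeffForm]
  rw [hfun] at h1
  exact h1.unique (Polynomial.hasDerivAt (a 0) t)

/-- **The end cost at rank three.**  For `a₀ ≢ 0` and real-rooted cubic fibres `Σ_{k≤3} X^k C(a_k(t))` (`t > 0`): at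
every `t > 0` with a non-zero fibre, `rootMultiplicity 0 (fibre) ≤ rootMultiplicity t a₀`. [folklore at `m ≤ 2`
(`no_fold_hyperbolic`); `m = 3`: `three_le_rootMultiplicity_of_triple_root`] -/
theorem endCost_three (a : ℕ → ℝ[X]) (ha0 : a 0 ≠ 0)
    (hsplit : ∀ t : ℝ, 0 < t → (∑ k ∈ Finset.range (3 + 1), (X : ℝ[X]) ^ k * Polynomial.C ((a k).eval t)).Splits)
    (t : ℝ) (ht : 0 < t) (hne : (∑ k ∈ Finset.range (3 + 1), (X : ℝ[X]) ^ k * Polynomial.C ((a k).eval t)) ≠ 0) :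
    (∑ k ∈ Finset.range (3 + 1), (X : ℝ[X]) ^ k * Polynomial.C ((a k).eval t)).rootMultiplicity 0 ≤
      (a 0).rootMultiplicity t := by
  set p : ℝ[X] := ∑ k ∈ Finset.range (3 + 1), (X : ℝ[X]) ^ k * Polynomial.C ((a k).eval t) with hp
  have hcoef : ∀ i, p.coeff i = if i < 3 + 1 then (a i).eval t else 0 := fun i => by
    rw [hp]; exact coeff_coeffForm 3 a t i
  -- derivatives at `0`
  have hd0 : p.eval 0 = (a 0).eval t := by rw [← coeff_zero_eq_eval_zero, hcoef]; simp
  have hd1 : (derivative p).eval 0 = (a 1).eval t := by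
    rw [← coeff_zero_eq_eval_zero, coeff_derivative, hcoef]; simp
  have hd2 : (derivative (derivative p)).eval 0 = 2 * (a 2).eval t := by
    rw [← coeff_zero_eq_eval_zero, coeff_derivative, coeff_derivative, hcoef]; norm_num; ring
  -- the `Φ`-currency for `no_fold_hyperbolic`
  have hP : ∀ u b, (∑ k ∈ Finset.range (3 + 1), (X : ℝ[X]) ^ k * Polynomial.C ((a k).eval u)).eval b =
      MvPolynomial.eval ![u, b] (∑ k ∈ Finset.range (3 + 1), (MvPolynomial.X 1 : MvPolynomial (Fin 2) ℝ) ^ k *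
        Polynomial.aeval (MvPolynomial.X 0 : MvPolynomial (Fin 2) ℝ) (a k)) := eval_coeffForm 3 a
  by_cases h0 : (a 0).eval t = 0
  swap
  · -- `0` is not a root of the fibre
    have hnot : ¬ p.IsRoot 0 := by rw [IsRoot, hd0]; exact h0
    rw [rootMultiplicity_eq_zero hnot]; exact Nat.zero_le _
  have hroot0 : (a 0).IsRoot t := h0
  have hge1 : 1 ≤ (a 0).rootMultiplicity t := (rootMultiplicity_pos ha0).2 hroot0
  by_cases h1 : (a 1).eval t = 0
  swap
  · -- simple root
    have hle : p.rootMultiplicity 0 ≤ 1 := by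
      by_contra hlt
      have hlt' : 1 < p.rootMultiplicity 0 := not_le.1 hlt
      have h2 := ((one_lt_rootMultiplicity_iff_isRoot hne).1 hlt').2
      rw [IsRoot, hd1] at h2
      exact h1 h2
    exact hle.trans hge1
  by_cases h2 : (a 2).eval t = 0
  swap
  · -- exactly double root: no fold
    have hle : p.rootMultiplicity 0 ≤ 2 := by
      by_contra hlt
      have h3 := (lt_rootMultiplicity_iff_isRoot_iterate_derivative hne).1 (show 2 < p.rootMultiplicity 0 by omega) 2 le_rfl
      rw [Function.iterate_succ, Function.iterate_one, Function.comp_apply, IsRoot, hd2] at h3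
      exact h2 (by linarith)
    have hfold := no_fold_hyperbolic _ _ hP hsplit ht (show MvPolynomial.eval ![t, 0] _ = 0 by rw [← hP, hd0, h0])
      (by rw [eval_pderiv_one_eq_derivative _ _ hP, hd1, h1])
      (by rw [eval_pderiv_one_one_eq _ _ hP, hd2]; exact mul_ne_zero two_ne_zero h2)
    rw [eval_pderiv_zero_at_zero] at hfold
    have hge2 : 1 < (a 0).rootMultiplicity t := (one_lt_rootMultiplicity_iff_isRoot ha0).2 ⟨hroot0, hfold⟩
    omega
  · -- triple root: the discriminant
    have h3 : (a 3).eval t ≠ 0 := by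
      intro h3
      apply hne
      ext i
      rw [hcoef, coeff_zero]
      by_cases hi : i < 3 + 1
      · rw [if_pos hi]
        interval_cases i <;> assumption
      · rw [if_neg hi]
    have hsplit' : ∀ u : ℝ, 0 < u → (Polynomial.C ((a 3).eval u) * X ^ 3 + Polynomial.C ((a 2).eval u) * X ^ 2 +
        Polynomial.C ((a 1).eval u) * X + Polynomial.C ((a 0).eval u)).Splits := by
      intro u hu
      have e : ∑ k ∈ Finset.range (3 + 1), (X : ℝ[X]) ^ k * Polynomial.C ((a k).eval u) =
          Polynomial.C ((a 3).eval u) * X ^ 3 + Polynomial.C ((a 2).eval u) * X ^ 2 +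
            Polynomial.C ((a 1).eval u) * X + Polynomial.C ((a 0).eval u) := by
        simp only [Finset.sum_range_succ, Finset.sum_range_zero]; ring
      rw [← e]; exact hsplit u hu
    have hge3 := three_le_rootMultiplicity_of_triple_root (a 0) (a 1) (a 2) (a 3) ht hsplit' ha0 h3 h0 h1 h2
    have hle : p.rootMultiplicity 0 ≤ 3 := by
      classical
      calc p.rootMultiplicity 0 = p.roots.count 0 := (count_roots p).symm
        _ ≤ Multiset.card p.roots := Multiset.count_le_card _ _
        _ ≤ p.natDegree := card_roots' p
        _ ≤ 3 := by rw [hp]; exact natDegree_coeffForm_le 3 a t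
    exact hle.trans hge3

end OsculationPeel

end Summit.ValiantsHypothesis.ValiantsHypothesis.Theorems.LacunarySymmetroidMatrixDescartes

end
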